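import Summits.HodgeConjecture.CorCM.IrreducibleOddWeightsIsotypicDensity
import Summits.HodgeConjecture.CorCM.IrreducibleOddWeightsShadowModules
import Mathlib.Algebra.Group.Action.Sum
import HarnessLib

/-!
# Isotypic cells, IX: THE MULTIPLICITY FORMULA — in an isotypic class built from an absolutely irreducible `A` by
# independent equivariant embeddings, `dim S(Σ_j ι_j b_j) = rank(b) · dim A` and the class defect is
# `dim(S(p₀) ∩ S(p₁)) = (rank(b) + rank(b′) − rank(b ⊔ b′)) · dim A`

COR-CM (cell `pub-hodgecm2`, binder seat `b16` gen 70, count-neutral claim ISOTYPIC SPLITTING OF THE DEFECT, file I9 —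
abstract `G`-set level; theorems only, no definition, no named fact, no `sorry`).  NEW as stated, hence under
`Summits/`.  HONEST FRAMING: linear algebra of translates of functions on finite `G`-sets (file I8's density and
dimension count for diagonal orbit modules, the lane's «row rank = column rank»); it turns file I5's quantisation
`d ∣ defect` into an exact count of the class defect of `dim Hg(A₀)+dim Hg(A₁)−dim Hg(A₀×A₁)` in terms of the RANK of
the tuple of components; `HC_CM` is neither used nor asserted.

SETTING.  A reference stable module `A ≤ ℚ^{Y}` (`Y` a finite `G`-set) and, for each `j ∈ J`, a linear
`ι_j : ℚ^{Y} → ℚ^{Y₀}` EQUIVARIANT on `A` (the constituents `ι_j(A)` of one isotypic class on the pivot `Y₀`), jointly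
INDEPENDENT on `A` (`Σ_j ι_j(f_j) = 0`, `f_j ∈ A` ⟹ all `f_j = 0`: each `ι_j` injective on `A` and the images independent);
a tuple `b : J → A` and the shadow `p₀ = Σ_j ι_j(b_j)`.  `rank(b) = dim span{b_j}`.

* §1 **ASSEMBLY** (`finrank_span_shadowCoeff_sum_eq_finrank_span_diag_orbit`): `dim S(p₀) = dim 𝔐(b)`, the diagonal
  orbit module of `b` (file I8): the assembly map `(f_j) ↦ Σ_j ι_j(f_j)` carries `𝔐(b)` injectively onto the translate
  module `M(p₀)`, and `dim M = dim S` (gen 69 Q3 §1).  No irreducibility.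
* §2 **`dim S(p₀) = rank(b) · dim A`** for `A` irreducible with scalar commutant
  (`finrank_span_shadowCoeff_sum_eq_rank_mul`): the EXACT multiplicity count behind file I5's `d ∣ dim S(p₀)`.
* §3 **THE CLASS DEFECT** (`finrank_span_shadowCoeff_inf_add_rank_mul_eq`): a second pivot `Y₁` with embeddings
  `ι′_k : ℚ^{Y} → ℚ^{Y₁}` of the same `A` and `p₁ = Σ_k ι′_k(b′_k)` ⟹
  **`dim(S(p₀) ∩ S(p₁)) + rank(b ⊔ b′)·dim A = (rank(b) + rank(b′))·dim A`**, `b ⊔ b′` the juxtaposed tuple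
  (through the disjoint-union pivot `Y₀ ⊕ Y₁`: `S(p₀) + S(p₁) = S(p₀ ⊔ p₁)`).  One constituent per side is gen 69
  Q3's dichotomy `{0, dim A}` (`b′ ∥ b` or not); in general the class defect COUNTS THE LINEAR RELATIONS between the
  components of the two shadows read in the reference module.

## References

* [Lang2002] S. Lang, *Algebra*, 3rd ed., XVII §3 (density), XVII §1.
* [Serre1977] J.-P. Serre, *Linear Representations of Finite Groups*, GTM 42, §2.6.
* [Gordon1999HodgeAVSurvey] B. B. Gordon, *A survey of the Hodge conjecture for abelian varieties*, §3 Theorem (proof),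
  7.5–7.7.
* [Deligne1982HodgeCycles] P. Deligne, *Hodge cycles on abelian varieties*, LNM 900, I §3 Ex. 3.7.
-/

set_option autoImplicit false

noncomputable section

open scoped BigOperators Classical

universe u u' v v' v'' w

namespace Summit.HodgeConjecture.CorCM.IrrOdd

variable {G : Type w} [Group G] {Y : Type v} [MulAction G Y] [Fintype Y]
  {Y₀ : Type v'} [MulAction G Y₀] [Fintype Y₀] {Y₁ : Type v''} [MulAction G Y₁] [Fintype Y₁]

/-! ### §1 Assembly: `dim S(Σ_j ι_j b_j) = dim 𝔐(b)` -/

/-- **ASSEMBLY.**  `ι_j : ℚ^{Y} → ℚ^{Y₀}` linear, equivariant on the stable `A`, jointly independent on `A`; `b : J → A`.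
Then the shadow-coefficient space of `p₀ = Σ_j ι_j(b_j)` has the dimension of the diagonal orbit module
`𝔐(b) = span{(b_j(g·))_j : g}`. [cite: Serre1977, §2.6] [cite: Deligne1982HodgeCycles, I §3 Ex. 3.7] -/
theorem finrank_span_shadowCoeff_sum_eq_finrank_span_diag_orbit {A : Submodule ℚ (Y → ℚ)}
    (hAst : ∀ (k : G) (a : Y → ℚ), a ∈ A → (fun y => a (k • y)) ∈ A)
    {J : Type u} [Fintype J] (ι : J → ((Y → ℚ) →ₗ[ℚ] (Y₀ → ℚ)))
    (hιeq : ∀ (j : J) (k : G) (a : Y → ℚ), a ∈ A → ι j (fun y => a (k • y)) = fun y => ι j a (k • y))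
    (hind : ∀ f : J → (Y → ℚ), (∀ j, f j ∈ A) → ∑ j, ι j (f j) = 0 → ∀ j, f j = 0)
    {b : J → (Y → ℚ)} (hb : ∀ j, b j ∈ A) :
    Module.finrank ℚ ↥(Submodule.span ℚ (Set.range fun y : Y₀ => fun g : G => (∑ j, ι j (b j)) (g • y))) =
      Module.finrank ℚ ↥(Submodule.span ℚ (Set.range fun g : G => fun j : J => fun y : Y => b j (g • y))) := by
  rw [← finrank_span_translate_eq_finrank_span_shadowCoeff]
  -- the assembly map
  let σ : (J → (Y → ℚ)) →ₗ[ℚ] (Y₀ → ℚ) := ∑ j, ι j ∘ₗ LinearMap.proj j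
  have hσ : ∀ f : J → (Y → ℚ), σ f = ∑ j, ι j (f j) := fun f => by
    simp [σ, LinearMap.sum_apply]
  -- it maps the diagonal orbit module onto the translate module of `p₀`
  have hmap : (Submodule.span ℚ (Set.range fun g : G => fun j : J => fun y : Y => b j (g • y))).map σ =
      Submodule.span ℚ (Set.range fun g : G => fun y : Y₀ => (∑ j, ι j (b j)) (g • y)) := by
    rw [Submodule.map_span, ← Set.range_comp]
    have hfun : ((σ : (J → (Y → ℚ)) → (Y₀ → ℚ)) ∘ fun g : G => fun j : J => fun y : Y => b j (g • y)) =
        fun g : G => fun y : Y₀ => (∑ j, ι j (b j)) (g • y) := by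
      funext g
      rw [Function.comp_apply, hσ,
        show (fun y : Y₀ => (∑ j, ι j (b j)) (g • y)) = ∑ j, fun y : Y₀ => ι j (b j) (g • y) by
          funext y; simp [Finset.sum_apply]]
      exact Finset.sum_congr rfl fun j _ => hιeq j g (b j) (hb j)
    rw [hfun]
  -- injectively: the orbit module consists of tuples in `A`
  have hle : Submodule.span ℚ (Set.range fun g : G => fun j : J => fun y : Y => b j (g • y)) ≤
      Submodule.pi Set.univ (fun _ : J => A) := by
    rw [Submodule.span_le]
    rintro _ ⟨g, rfl⟩ j -
    exact hAst g _ (hb j)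
  have hk : LinearMap.ker (σ.domRestrict
      (Submodule.span ℚ (Set.range fun g : G => fun j : J => fun y : Y => b j (g • y)))) = ⊥ := by
    rw [eq_bot_iff]
    intro f hf
    rw [Submodule.mem_bot]
    have h0 : σ f = 0 := hf
    rw [hσ] at h0
    exact Subtype.ext (funext fun j => hind _ (fun j => hle f.2 j trivial) h0 j)
  rw [← hmap, ← LinearMap.range_domRestrict]
  have h := LinearMap.finrank_range_add_finrank_ker
    (σ.domRestrict (Submodule.span ℚ (Set.range fun g : G => fun j : J => fun y : Y => b j (g • y))))
  rw [hk, finrank_bot, add_zero] at h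
  exact h

/-! ### §2 `dim S(p₀) = rank(b) · dim A` -/

/-- **THE MULTIPLICITY COUNT: `dim S(Σ_j ι_j b_j) = rank(b) · dim A`** for `A` stable irreducible with SCALAR
COMMUTANT, `ι_j` equivariant and jointly independent on `A`, `b : J → A`.  File I5 gave `dim A ∣ dim S`; density
(file I8) counts the multiple. [cite: Lang2002, XVII §3] [cite: Serre1977, §2.6] -/
theorem finrank_span_shadowCoeff_sum_eq_rank_mul {A : Submodule ℚ (Y → ℚ)}
    (hAst : ∀ (k : G) (a : Y → ℚ), a ∈ A → (fun y => a (k • y)) ∈ A)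
    (hAirr : ∀ W : Submodule ℚ (Y → ℚ), W ≤ A → W ≠ ⊥ →
      (∀ (k : G) (f : Y → ℚ), f ∈ W → (fun y => f (k • y)) ∈ W) → W = A)
    (hsc : ∀ L : (Y → ℚ) →ₗ[ℚ] (Y → ℚ), (∀ a ∈ A, L a ∈ A) →
      (∀ (k : G) (a : Y → ℚ), a ∈ A → L (fun y => a (k • y)) = fun y => L a (k • y)) → ∃ c : ℚ, ∀ a ∈ A, L a = c • a)
    {J : Type u} [Fintype J] (ι : J → ((Y → ℚ) →ₗ[ℚ] (Y₀ → ℚ)))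
    (hιeq : ∀ (j : J) (k : G) (a : Y → ℚ), a ∈ A → ι j (fun y => a (k • y)) = fun y => ι j a (k • y))
    (hind : ∀ f : J → (Y → ℚ), (∀ j, f j ∈ A) → ∑ j, ι j (f j) = 0 → ∀ j, f j = 0)
    {b : J → (Y → ℚ)} (hb : ∀ j, b j ∈ A) :
    Module.finrank ℚ ↥(Submodule.span ℚ (Set.range fun y : Y₀ => fun g : G => (∑ j, ι j (b j)) (g • y))) =
      Module.finrank ℚ ↥(Submodule.span ℚ (Set.range b)) * Module.finrank ℚ A := by
  rw [finrank_span_shadowCoeff_sum_eq_finrank_span_diag_orbit hAst ι hιeq hind hb]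
  let T : G → (Y → ℚ) →ₗ[ℚ] (Y → ℚ) := fun k => LinearMap.funLeft ℚ ℚ (fun y : Y => k • y)
  have h1 : ∃ i₀ : G, T i₀ = LinearMap.id :=
    ⟨1, LinearMap.ext fun f => funext fun y => by simp [T, LinearMap.funLeft_apply]⟩
  have hmul : ∀ i i' : G, ∃ i'' : G, T i'' = T i ∘ₗ T i' :=
    fun i i' => ⟨i' * i, LinearMap.ext fun f => funext fun y => by simp [T, LinearMap.funLeft_apply, mul_smul]⟩
  exact finrank_span_diag_orbit_eq_mul T h1 hmul (A := A) (fun k a ha => hAst k a ha)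
    (fun W hW hW0 hWst => hAirr W hW hW0 fun k f hf => hWst k f hf) (fun L hL hLeq => hsc L hL fun k a ha => hLeq k a ha)
    hb

/-! ### §3 The class defect: two pivots through the disjoint union -/

/-- **THE CLASS DEFECT COUNTS RELATIONS: `dim(S(p₀) ∩ S(p₁)) + rank(b ⊔ b′)·dim A = (rank b + rank b′)·dim A`.**
`A` stable irreducible with scalar commutant; `p₀ = Σ_j ι_j(b_j)` on `Y₀` and `p₁ = Σ_k ι′_k(b′_k)` on `Y₁` for
equivariant, jointly independent embeddings of `A`; `b ⊔ b′ = Sum.elim b b′`.  (Through the disjoint-union pivot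
`Y₀ ⊕ Y₁`, where `S(p₀ ⊔ p₁) = S(p₀) + S(p₁)`.) [cite: Lang2002, XVII §3] [cite: Serre1977, §2.6]
[cite: Gordon1999HodgeAVSurvey, §3 Theorem (proof), 7.5–7.7] -/
theorem finrank_span_shadowCoeff_inf_add_rank_mul_eq {A : Submodule ℚ (Y → ℚ)}
    (hAst : ∀ (k : G) (a : Y → ℚ), a ∈ A → (fun y => a (k • y)) ∈ A)
    (hAirr : ∀ W : Submodule ℚ (Y → ℚ), W ≤ A → W ≠ ⊥ →
      (∀ (k : G) (f : Y → ℚ), f ∈ W → (fun y => f (k • y)) ∈ W) → W = A)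
    (hsc : ∀ L : (Y → ℚ) →ₗ[ℚ] (Y → ℚ), (∀ a ∈ A, L a ∈ A) →
      (∀ (k : G) (a : Y → ℚ), a ∈ A → L (fun y => a (k • y)) = fun y => L a (k • y)) → ∃ c : ℚ, ∀ a ∈ A, L a = c • a)
    {J₀ : Type u} {J₁ : Type u'} [Fintype J₀] [Fintype J₁]
    (ι₀ : J₀ → ((Y → ℚ) →ₗ[ℚ] (Y₀ → ℚ))) (ι₁ : J₁ → ((Y → ℚ) →ₗ[ℚ] (Y₁ → ℚ)))
    (hι₀eq : ∀ (j : J₀) (k : G) (a : Y → ℚ), a ∈ A → ι₀ j (fun y => a (k • y)) = fun y => ι₀ j a (k • y))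
    (hι₁eq : ∀ (j : J₁) (k : G) (a : Y → ℚ), a ∈ A → ι₁ j (fun y => a (k • y)) = fun y => ι₁ j a (k • y))
    (hind₀ : ∀ f : J₀ → (Y → ℚ), (∀ j, f j ∈ A) → ∑ j, ι₀ j (f j) = 0 → ∀ j, f j = 0)
    (hind₁ : ∀ f : J₁ → (Y → ℚ), (∀ j, f j ∈ A) → ∑ j, ι₁ j (f j) = 0 → ∀ j, f j = 0)
    {b₀ : J₀ → (Y → ℚ)} {b₁ : J₁ → (Y → ℚ)} (hb₀ : ∀ j, b₀ j ∈ A) (hb₁ : ∀ j, b₁ j ∈ A) :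
    Module.finrank ℚ ↥(Submodule.span ℚ (Set.range fun y : Y₀ => fun g : G => (∑ j, ι₀ j (b₀ j)) (g • y)) ⊓
          Submodule.span ℚ (Set.range fun y : Y₁ => fun g : G => (∑ j, ι₁ j (b₁ j)) (g • y))) +
        Module.finrank ℚ ↥(Submodule.span ℚ (Set.range (Sum.elim b₀ b₁))) * Module.finrank ℚ A =
      (Module.finrank ℚ ↥(Submodule.span ℚ (Set.range b₀)) + Module.finrank ℚ ↥(Submodule.span ℚ (Set.range b₁))) *
        Module.finrank ℚ A := by
  -- extension by zero to the disjoint-union pivot `Y₀ ⊕ Y₁`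
  let E₀ : (Y₀ → ℚ) →ₗ[ℚ] (Y₀ ⊕ Y₁ → ℚ) :=
    { toFun := fun f => Sum.elim f 0
      map_add' := fun f f' => by funext z; cases z <;> simp
      map_smul' := fun t f => by funext z; cases z <;> simp }
  let E₁ : (Y₁ → ℚ) →ₗ[ℚ] (Y₀ ⊕ Y₁ → ℚ) :=
    { toFun := fun f => Sum.elim 0 f
      map_add' := fun f f' => by funext z; cases z <;> simp
      map_smul' := fun t f => by funext z; cases z <;> simp }
  have hE₀ : ∀ (f : Y₀ → ℚ) (z : Y₀ ⊕ Y₁), E₀ f z = Sum.elim f (0 : Y₁ → ℚ) z := fun f z => rfl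
  have hE₁ : ∀ (f : Y₁ → ℚ) (z : Y₀ ⊕ Y₁), E₁ f z = Sum.elim (0 : Y₀ → ℚ) f z := fun f z => rfl
  let ι : J₀ ⊕ J₁ → ((Y → ℚ) →ₗ[ℚ] (Y₀ ⊕ Y₁ → ℚ)) := Sum.elim (fun j => E₀ ∘ₗ ι₀ j) (fun j => E₁ ∘ₗ ι₁ j)
  have hιeq : ∀ (s : J₀ ⊕ J₁) (k : G) (a : Y → ℚ), a ∈ A → ι s (fun y => a (k • y)) = fun z => ι s a (k • z) := by
    rintro (j | j) k a ha
    · show E₀ (ι₀ j (fun y => a (k • y))) = fun z => E₀ (ι₀ j a) (k • z)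
      rw [hι₀eq j k a ha]
      funext z
      cases z with
      | inl y => rw [Sum.smul_inl, hE₀, hE₀]; rfl
      | inr y => rw [Sum.smul_inr, hE₀, hE₀]; rfl
    · show E₁ (ι₁ j (fun y => a (k • y))) = fun z => E₁ (ι₁ j a) (k • z)
      rw [hι₁eq j k a ha]
      funext z
      cases z with
      | inl y => rw [Sum.smul_inl, hE₁, hE₁]; rfl
      | inr y => rw [Sum.smul_inr, hE₁, hE₁]; rfl
  have hsum : ∀ f : J₀ ⊕ J₁ → (Y → ℚ), ∑ s, ι s (f s) =
      E₀ (∑ j, ι₀ j (f (Sum.inl j))) + E₁ (∑ j, ι₁ j (f (Sum.inr j))) := fun f => by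
    rw [Fintype.sum_sum_type, map_sum, map_sum]
    rfl
  have hind : ∀ f : J₀ ⊕ J₁ → (Y → ℚ), (∀ s, f s ∈ A) → ∑ s, ι s (f s) = 0 → ∀ s, f s = 0 := by
    intro f hf h0
    rw [hsum] at h0
    have h₀ : ∑ j, ι₀ j (f (Sum.inl j)) = 0 := by
      funext y
      have h := congrFun h0 (Sum.inl y)
      simpa [hE₀, hE₁] using h
    have h₁ : ∑ j, ι₁ j (f (Sum.inr j)) = 0 := by
      funext y
      have h := congrFun h0 (Sum.inr y)
      simpa [hE₀, hE₁] using h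
    rintro (j | j)
    · exact hind₀ (fun j => f (Sum.inl j)) (fun j => hf _) h₀ j
    · exact hind₁ (fun j => f (Sum.inr j)) (fun j => hf _) h₁ j
  have hb : ∀ s : J₀ ⊕ J₁, Sum.elim b₀ b₁ s ∈ A := by
    rintro (j | j)
    · exact hb₀ j
    · exact hb₁ j
  -- the juxtaposed shadow on `Y₀ ⊕ Y₁` and its shadow-coefficient space `S(p₀) ⊔ S(p₁)`
  have hp : ∑ s, ι s (Sum.elim b₀ b₁ s) = E₀ (∑ j, ι₀ j (b₀ j)) + E₁ (∑ j, ι₁ j (b₁ j)) := by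
    rw [hsum]
    rfl
  have hS : Submodule.span ℚ (Set.range fun z : Y₀ ⊕ Y₁ => fun g : G => (∑ s, ι s (Sum.elim b₀ b₁ s)) (g • z)) =
      Submodule.span ℚ (Set.range fun y : Y₀ => fun g : G => (∑ j, ι₀ j (b₀ j)) (g • y)) ⊔
        Submodule.span ℚ (Set.range fun y : Y₁ => fun g : G => (∑ j, ι₁ j (b₁ j)) (g • y)) := by
    rw [← Submodule.span_union, ← Set.Sum.elim_range]
    congr 1
    congr 1
    funext z
    cases z with
    | inl y =>
      funext g
      rw [hp, Sum.smul_inl]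
      simp [hE₀, hE₁]
    | inr y =>
      funext g
      rw [hp, Sum.smul_inr]
      simp [hE₀, hE₁]
  have hsup := finrank_span_shadowCoeff_sum_eq_rank_mul (Y₀ := Y₀ ⊕ Y₁) hAst hAirr hsc ι hιeq hind hb
  rw [hS] at hsup
  have hU := finrank_span_shadowCoeff_sum_eq_rank_mul hAst hAirr hsc ι₀ hι₀eq hind₀ hb₀
  have hU' := finrank_span_shadowCoeff_sum_eq_rank_mul hAst hAirr hsc ι₁ hι₁eq hind₁ hb₁
  haveI : FiniteDimensional ℚ ↥(Submodule.span ℚ (Set.range fun y : Y₀ => fun g : G =>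
      (∑ j, ι₀ j (b₀ j)) (g • y))) := FiniteDimensional.span_of_finite ℚ (Set.finite_range _)
  haveI : FiniteDimensional ℚ ↥(Submodule.span ℚ (Set.range fun y : Y₁ => fun g : G =>
      (∑ j, ι₁ j (b₁ j)) (g • y))) := FiniteDimensional.span_of_finite ℚ (Set.finite_range _)
  have h := Submodule.finrank_sup_add_finrank_inf_eq
    (Submodule.span ℚ (Set.range fun y : Y₀ => fun g : G => (∑ j, ι₀ j (b₀ j)) (g • y)))
    (Submodule.span ℚ (Set.range fun y : Y₁ => fun g : G => (∑ j, ι₁ j (b₁ j)) (g • y)))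
  rw [hsup, hU, hU'] at h
  rw [add_mul, ← h, add_comm]

end Summit.HodgeConjecture.CorCM.IrrOdd

end
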